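import Literature.NumberTheory.LFunctions.EntireZeroSumTail
import Literature.NumberTheory.LFunctions.ThornerZamanWeight
import HarnessLib

/-!
# The zero sum against the Thorner–Zaman weight, one entire function

Topic `Literature/NumberTheory/LFunctions`, sub-namespace `EntireEF`. Everything here is PROVED.

For an entire `f` (not identically zero) with a window bound `(W, A)` for its non-trivial zeros,
the test function `g = tzTest L ε` (`L = log x`, `0 < ε < L/2`) and a height `T₁ ≥ 1`, every finite
partial sum of the zero terms of the explicit formula, `Σ m(ρ) ‖F(−ρ)‖` (`F` the Laplace transform of
`g`, a finite set `Exc` of excluded zeros allowed), is at most `x e^ε` times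

  `8M Σ_{|γ| ≤ T₁, β ≥ 1/4, ρ ∉ Exc} m(ρ) x^{β−1}/max(1,|γ|) + (L + ε + 8M) x^{−3/4} Σ_{|γ| ≤ T₁} m(ρ) + (2M/ε) T₁^{−1/2} W (c₁A + c₂)`

(`sum_zeroTerm_le`), using `‖F(−ρ)‖ ≤ x^β e^ε · min(L + ε, 2M/|ρ|, (2M/ε)/|ρ|²)` (`ThornerZamanWeight`)
and the tail `Σ_{|γ| ≥ T₁} m/|ρ|² ≤ T₁^{−1/2} W(c₁A + c₂)` (`EntireZeroSumTail`). This is the per-function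
half of Thorner–Zaman (2019) Lemmas 4.4–4.5; the density step is `LinnikZeroSum.sum_rpow_div_le_of_density_zfr`.

## References

* J. Thorner, A. Zaman, ANT 13 (2019), Lemmas 4.4, 4.5. [ThornerZaman2019]
-/

noncomputable section

open Complex Filter Topology Set Finset

namespace Literature.NumberTheory.LFunctions.EntireEF

open Literature.NumberTheory.LFunctions.TZWeight

variable {f : ℂ → ℂ}

/-- `E(−ρ) = x^β e^{βε} ≤ x^β e^{ε}` for `0 < β ≤ 1`, `x = e^L`. [folklore] -/
theorem edgeExp_neg_le {L ε : ℝ} (hL : 0 < L) (hε : 0 < ε) {ρ : ℂ} (h0 : 0 < ρ.re) (h1 : ρ.re ≤ 1) :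
    edgeExp L ε (-ρ) ≤ Real.exp L ^ ρ.re * Real.exp ε := by
  rw [edgeExp]
  have hre : (-ρ).re = -ρ.re := by simp
  rw [hre]
  have hval : Real.exp L ^ ρ.re * Real.exp ε = Real.exp (ρ.re * L + ε) := by
    rw [← Real.exp_mul, ← Real.exp_add]; ring_nf
  rw [hval]
  refine max_le (Real.exp_le_exp.2 (by nlinarith)) (Real.exp_le_exp.2 (by nlinarith))

/-- **The zero terms of one function against the TZ weight** (see the module docstring). [cite: ThornerZaman2019, Lemmas 4.4–4.5] -/
theorem sum_zeroTerm_le (hf : Differentiable ℂ f) {c : ℂ} (hc : f c ≠ 0) {W A : ℝ} (hW : 0 ≤ W) (hA : 0 ≤ A)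
    (hwin : ∀ (τ : ℝ) (P : Finset ℂ), (∀ ρ ∈ P, f ρ = 0 ∧ 0 < ρ.re ∧ ρ.re < 1 ∧ |ρ.im - τ| ≤ 1 / 2) →
      ∑ ρ ∈ P, (analyticOrderNatAt f ρ : ℝ) ≤ W * (A + Real.log (|τ| + 4)))
    {M : ℝ} (hM : ∀ y : ℝ, |iteratedDeriv 1 Real.smoothTransition y| ≤ M ∧ |iteratedDeriv 2 Real.smoothTransition y| ≤ M)
    {L ε : ℝ} (hL : 0 < L) (hε : 0 < ε) (hεL : ε < L / 2) {T₁ : ℝ} (hT₁ : 1 ≤ T₁) (Exc : Finset ℂ)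
    (u : Finset (nontrivialZeros f)) :
    ∑ ρ ∈ u.filter (fun ρ : nontrivialZeros f ↦ (ρ : ℂ) ∉ Exc), (analyticOrderNatAt f (ρ : ℂ) : ℝ) * ‖fordLaplace (tzTest L ε) (-(ρ : ℂ))‖ ≤
      Real.exp ε * Real.exp L *
        (8 * M * ∑ ρ ∈ (finite_nontrivialZeros_inter hf hc T₁).toFinset with (ρ ∉ Exc ∧ 1 / 4 ≤ ρ.re),
            (analyticOrderNatAt f ρ : ℝ) * Real.exp L ^ (ρ.re - 1) / max 1 |ρ.im| +
          (L + ε + 8 * M) * Real.exp L ^ (-(3 : ℝ) / 4) * ∑ ρ ∈ (finite_nontrivialZeros_inter hf hc T₁).toFinset, (analyticOrderNatAt f ρ : ℝ) +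
          (2 * M / ε) * T₁ ^ (-((1 : ℝ) / 2)) * (W * (tailConst₁ * A + tailConst₂))) := by
  classical
  set x : ℝ := Real.exp L with hx
  have hx0 : 0 < x := Real.exp_pos L
  have hlogx : Real.log x = L := Real.log_exp L
  have hM0 : 0 ≤ M := le_trans (abs_nonneg _) (hM 0).1
  set m : ℂ → ℝ := fun ρ ↦ (analyticOrderNatAt f ρ : ℝ) with hm
  have hm0 : ∀ ρ, 0 ≤ m ρ := fun ρ ↦ Nat.cast_nonneg _
  set Fin := (finite_nontrivialZeros_inter hf hc T₁).toFinset with hFin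
  have hmemFin : ∀ ρ : ℂ, ρ ∈ Fin ↔ (f ρ = 0 ∧ 0 < ρ.re ∧ ρ.re < 1) ∧ |ρ.im| ≤ T₁ := by
    intro ρ; rw [hFin, Set.Finite.mem_toFinset]; rfl
  -- the three bounds for `‖F(−ρ)‖`
  have hE : ∀ ρ : nontrivialZeros f, edgeExp L ε (-(ρ : ℂ)) ≤ x ^ (ρ : ℂ).re * Real.exp ε :=
    fun ρ ↦ edgeExp_neg_le hL hε ρ.2.2.1 ρ.2.2.2.le
  have hF₀ : ∀ ρ : nontrivialZeros f, ‖fordLaplace (tzTest L ε) (-(ρ : ℂ))‖ ≤ x ^ (ρ : ℂ).re * Real.exp ε * (L + ε) :=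
    fun ρ ↦ (norm_fordLaplace_tzTest_le₀ hL hε hεL _).trans (mul_le_mul_of_nonneg_right (hE ρ) (by linarith))
  have hρ0 : ∀ ρ : nontrivialZeros f, (-(ρ : ℂ)) ≠ 0 := fun ρ h ↦ by
    have := ρ.2.2.1; rw [neg_eq_zero] at h; rw [h] at this; simp at this
  have hF₁ : ∀ ρ : nontrivialZeros f, ‖fordLaplace (tzTest L ε) (-(ρ : ℂ))‖ ≤ x ^ (ρ : ℂ).re * Real.exp ε * (2 * M) / ‖(ρ : ℂ)‖ := by
    intro ρ
    have h := (norm_fordLaplace_tzTest_le hM hL hε hεL (hρ0 ρ)).1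
    rw [norm_neg] at h
    exact h.trans (div_le_div_of_nonneg_right (mul_le_mul_of_nonneg_right (hE ρ) (by positivity)) (norm_nonneg _))
  have hF₂ : ∀ ρ : nontrivialZeros f, ‖fordLaplace (tzTest L ε) (-(ρ : ℂ))‖ ≤ x ^ (ρ : ℂ).re * Real.exp ε * (2 * M / ε) / ‖(ρ : ℂ)‖ ^ 2 := by
    intro ρ
    have h := (norm_fordLaplace_tzTest_le hM hL hε hεL (hρ0 ρ)).2
    rw [norm_neg] at h
    exact h.trans (div_le_div_of_nonneg_right (mul_le_mul_of_nonneg_right (hE ρ) (by positivity)) (by positivity))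
  -- split at height `T₁`
  set u₁ := (u.filter fun ρ : nontrivialZeros f ↦ (ρ : ℂ) ∉ Exc).filter (fun ρ : nontrivialZeros f ↦ |(ρ : ℂ).im| ≤ T₁) with hu₁
  set u₂ := (u.filter fun ρ : nontrivialZeros f ↦ (ρ : ℂ) ∉ Exc).filter (fun ρ : nontrivialZeros f ↦ ¬ |(ρ : ℂ).im| ≤ T₁) with hu₂
  rw [← Finset.sum_filter_add_sum_filter_not (u.filter fun ρ : nontrivialZeros f ↦ (ρ : ℂ) ∉ Exc) (fun ρ : nontrivialZeros f ↦ |(ρ : ℂ).im| ≤ T₁)]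
  -- (a) the finite part `|γ| ≤ T₁`
  have hxpow : ∀ b : ℝ, x ^ b = x * x ^ (b - 1) := fun b ↦ by
    rw [Real.rpow_sub_one hx0.ne']; field_simp
  have hx34 : ∀ {b : ℝ}, b < 1 / 4 → x ^ b ≤ x * x ^ (-(3 : ℝ) / 4) := by
    intro b hb
    rw [show x * x ^ (-(3:ℝ) / 4) = x ^ ((1 : ℝ) / 4) by
      rw [show -(3:ℝ)/4 = (1:ℝ)/4 - 1 by norm_num, ← hxpow]]
    exact Real.rpow_le_rpow_of_exponent_le (by rw [hx]; exact Real.one_le_exp hL.le) hb.le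
  have hpart1 : ∑ ρ ∈ u₁, m ρ * ‖fordLaplace (tzTest L ε) (-(ρ : ℂ))‖ ≤
      Real.exp ε * x * (8 * M * ∑ ρ ∈ Fin with (ρ ∉ Exc ∧ 1 / 4 ≤ ρ.re), m ρ * x ^ (ρ.re - 1) / max 1 |ρ.im| +
        (L + ε + 8 * M) * x ^ (-(3 : ℝ) / 4) * ∑ ρ ∈ Fin, m ρ) := by
    -- pointwise bound
    have hpt : ∀ ρ ∈ u₁, m ρ * ‖fordLaplace (tzTest L ε) (-(ρ : ℂ))‖ ≤
        Real.exp ε * x * (8 * M * (if (1 / 4 : ℝ) ≤ (ρ : ℂ).re then m ρ * x ^ ((ρ : ℂ).re - 1) / max 1 |(ρ : ℂ).im| else 0) +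
          (L + ε + 8 * M) * x ^ (-(3 : ℝ) / 4) * m ρ) := by
      intro ρ _
      have hβ0 := ρ.2.2.1
      have hβ1 := ρ.2.2.2
      have hmρ := hm0 ρ
      have hx34' : 0 ≤ (L + ε + 8 * M) * x ^ (-(3 : ℝ) / 4) * m ρ := by positivity
      by_cases hβ : (1 / 4 : ℝ) ≤ (ρ : ℂ).re
      · rw [if_pos hβ]
        -- `‖ρ‖ ≥ max(1/4, |γ|)` so `2M/‖ρ‖ ≤ 8M/max(1,|γ|)`
        have hρn : max ((1 : ℝ) / 4) |(ρ : ℂ).im| ≤ ‖(ρ : ℂ)‖ :=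
          max_le (hβ.trans (Complex.re_le_norm _)) (Complex.abs_im_le_norm _)
        have hρpos : 0 < ‖(ρ : ℂ)‖ := lt_of_lt_of_le (by norm_num) hρn
        have hmax1 : 0 < max 1 |(ρ : ℂ).im| := lt_of_lt_of_le one_pos (le_max_left _ _)
        have hkey : 2 * M / ‖(ρ : ℂ)‖ ≤ 8 * M / max 1 |(ρ : ℂ).im| := by
          rw [div_le_div_iff₀ hρpos hmax1]
          -- `max(1,|γ|) ≤ 4 max(1/4, |γ|) ≤ 4‖ρ‖`
          have : max 1 |(ρ : ℂ).im| ≤ 4 * ‖(ρ : ℂ)‖ := by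
            refine max_le (by linarith [le_max_left ((1:ℝ)/4) |(ρ : ℂ).im|]) ?_
            linarith [le_max_right ((1:ℝ)/4) |(ρ : ℂ).im|, abs_nonneg ((ρ : ℂ).im)]
          nlinarith
        calc m ρ * ‖fordLaplace (tzTest L ε) (-(ρ : ℂ))‖ ≤ m ρ * (x ^ (ρ : ℂ).re * Real.exp ε * (2 * M) / ‖(ρ : ℂ)‖) :=
              mul_le_mul_of_nonneg_left (hF₁ ρ) hmρ
          _ = m ρ * (x ^ (ρ : ℂ).re * Real.exp ε) * (2 * M / ‖(ρ : ℂ)‖) := by ring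
          _ ≤ m ρ * (x ^ (ρ : ℂ).re * Real.exp ε) * (8 * M / max 1 |(ρ : ℂ).im|) :=
              mul_le_mul_of_nonneg_left hkey (by positivity)
          _ = Real.exp ε * x * (8 * M * (m ρ * x ^ ((ρ : ℂ).re - 1) / max 1 |(ρ : ℂ).im|)) := by
              rw [hxpow (ρ : ℂ).re]; field_simp
          _ ≤ _ := by
              have h0 : 0 ≤ Real.exp ε * x * ((L + ε + 8 * M) * x ^ (-(3 : ℝ) / 4) * m ρ) := by positivity
              nlinarith [h0]
      · rw [if_neg hβ, mul_zero, zero_add]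
        rw [not_le] at hβ
        -- `‖F‖ ≤ x^β e^ε (L + ε)` if `‖ρ‖` small, and `≤ x^β e^ε 8M` if `‖ρ‖ ≥ 1/4`; both `≤ x^β e^ε (L + ε + 8M)`
        have hFb : ‖fordLaplace (tzTest L ε) (-(ρ : ℂ))‖ ≤ x ^ (ρ : ℂ).re * Real.exp ε * (L + ε + 8 * M) := by
          rcases lt_or_ge ‖(ρ : ℂ)‖ (1 / 4) with hsmall | hbig
          · exact (hF₀ ρ).trans (mul_le_mul_of_nonneg_left (by linarith) (by positivity))
          · have hρpos : 0 < ‖(ρ : ℂ)‖ := by linarith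
            have h8 : 2 * M / ‖(ρ : ℂ)‖ ≤ 8 * M := by
              rw [div_le_iff₀ hρpos]; nlinarith
            calc ‖fordLaplace (tzTest L ε) (-(ρ : ℂ))‖ ≤ x ^ (ρ : ℂ).re * Real.exp ε * (2 * M) / ‖(ρ : ℂ)‖ := hF₁ ρ
              _ = x ^ (ρ : ℂ).re * Real.exp ε * (2 * M / ‖(ρ : ℂ)‖) := by ring
              _ ≤ x ^ (ρ : ℂ).re * Real.exp ε * (8 * M) := mul_le_mul_of_nonneg_left h8 (by positivity)
              _ ≤ x ^ (ρ : ℂ).re * Real.exp ε * (L + ε + 8 * M) := mul_le_mul_of_nonneg_left (by linarith) (by positivity)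
        calc m ρ * ‖fordLaplace (tzTest L ε) (-(ρ : ℂ))‖ ≤ m ρ * (x ^ (ρ : ℂ).re * Real.exp ε * (L + ε + 8 * M)) :=
              mul_le_mul_of_nonneg_left hFb hmρ
          _ ≤ m ρ * (x * x ^ (-(3 : ℝ) / 4) * Real.exp ε * (L + ε + 8 * M)) := by
              refine mul_le_mul_of_nonneg_left ?_ hmρ
              have := hx34 hβ
              have h0 : 0 ≤ Real.exp ε * (L + ε + 8 * M) := by positivity
              nlinarith
          _ = Real.exp ε * x * ((L + ε + 8 * M) * x ^ (-(3 : ℝ) / 4) * m ρ) := by ring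
    refine (Finset.sum_le_sum hpt).trans ?_
    rw [← Finset.mul_sum, Finset.sum_add_distrib, ← Finset.mul_sum, ← Finset.mul_sum, ← Finset.sum_filter]
    refine mul_le_mul_of_nonneg_left (add_le_add ?_ ?_) (by positivity)
    · refine mul_le_mul_of_nonneg_left ?_ (by positivity)
      -- compare the sums through `Subtype.val`
      have hinj : Set.InjOn (Subtype.val : nontrivialZeros f → ℂ) ↑(u₁.filter fun ρ : nontrivialZeros f ↦ (1 / 4 : ℝ) ≤ (ρ : ℂ).re) :=
        fun a _ b _ h ↦ Subtype.ext h
      rw [← Finset.sum_image (f := fun ρ : ℂ ↦ m ρ * x ^ (ρ.re - 1) / max 1 |ρ.im|) hinj]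
      refine Finset.sum_le_sum_of_subset_of_nonneg ?_ fun ρ _ _ ↦ by
        exact div_nonneg (mul_nonneg (hm0 ρ) (Real.rpow_nonneg hx0.le _)) (by positivity)
      intro z hz
      obtain ⟨ρ, hρ, rfl⟩ := Finset.mem_image.1 hz
      rw [Finset.mem_filter] at hρ ⊢
      rw [hu₁, Finset.mem_filter, Finset.mem_filter] at hρ
      exact ⟨(hmemFin _).2 ⟨ρ.2, hρ.1.2⟩, hρ.1.1.2, hρ.2⟩
    · refine mul_le_mul_of_nonneg_left ?_ (by positivity)
      have hinj : Set.InjOn (Subtype.val : nontrivialZeros f → ℂ) ↑u₁ := fun a _ b _ h ↦ Subtype.ext h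
      rw [← Finset.sum_image (f := fun ρ : ℂ ↦ m ρ) hinj]
      refine Finset.sum_le_sum_of_subset_of_nonneg ?_ fun ρ _ _ ↦ hm0 ρ
      intro z hz
      obtain ⟨ρ, hρ, rfl⟩ := Finset.mem_image.1 hz
      rw [hu₁, Finset.mem_filter, Finset.mem_filter] at hρ
      exact (hmemFin _).2 ⟨ρ.2, hρ.2⟩
  -- (b) the tail `|γ| > T₁`
  have hpart2 : ∑ ρ ∈ u₂, m ρ * ‖fordLaplace (tzTest L ε) (-(ρ : ℂ))‖ ≤
      Real.exp ε * x * ((2 * M / ε) * T₁ ^ (-((1 : ℝ) / 2)) * (W * (tailConst₁ * A + tailConst₂))) := by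
    obtain ⟨hsumT, htail⟩ := tsum_tail_div_normSq_le hW hA hwin hT₁
    set G : nontrivialZeros f → ℝ := fun ρ ↦
      if T₁ ≤ |(ρ : ℂ).im| then (analyticOrderNatAt f (ρ : ℂ) : ℝ) / ‖(ρ : ℂ)‖ ^ 2 else 0 with hG
    have hG0 : ∀ ρ, 0 ≤ G ρ := fun ρ ↦ by rw [hG]; dsimp only; split_ifs <;> positivity
    have hpt : ∀ ρ ∈ u₂, m ρ * ‖fordLaplace (tzTest L ε) (-(ρ : ℂ))‖ ≤ Real.exp ε * x * (2 * M / ε) * G ρ := by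
      intro ρ hρ
      rw [hu₂, Finset.mem_filter, not_le] at hρ
      have hγ : T₁ ≤ |(ρ : ℂ).im| := hρ.2.le
      rw [hG]; dsimp only; rw [if_pos hγ]
      have hβ1 := ρ.2.2.2
      have hxβ : x ^ (ρ : ℂ).re ≤ x := by
        conv_rhs => rw [← Real.rpow_one x]
        exact Real.rpow_le_rpow_of_exponent_le (by rw [hx]; exact Real.one_le_exp hL.le) hβ1.le
      have hρpos : 0 < ‖(ρ : ℂ)‖ := by
        have := Complex.abs_im_le_norm (ρ : ℂ); linarith [abs_nonneg ((ρ : ℂ).im)]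
      calc m ρ * ‖fordLaplace (tzTest L ε) (-(ρ : ℂ))‖ ≤ m ρ * (x ^ (ρ : ℂ).re * Real.exp ε * (2 * M / ε) / ‖(ρ : ℂ)‖ ^ 2) :=
            mul_le_mul_of_nonneg_left (hF₂ ρ) (hm0 _)
        _ ≤ m ρ * (x * Real.exp ε * (2 * M / ε) / ‖(ρ : ℂ)‖ ^ 2) := by
            refine mul_le_mul_of_nonneg_left (div_le_div_of_nonneg_right ?_ (by positivity)) (hm0 _)
            exact mul_le_mul_of_nonneg_right (mul_le_mul_of_nonneg_right hxβ (by positivity)) (by positivity)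
        _ = Real.exp ε * x * (2 * M / ε) * ((analyticOrderNatAt f (ρ : ℂ) : ℝ) / ‖(ρ : ℂ)‖ ^ 2) := by rw [hm]; ring
    refine (Finset.sum_le_sum hpt).trans ?_
    rw [← Finset.mul_sum, mul_assoc (Real.exp ε * x)]
    refine mul_le_mul_of_nonneg_left ?_ (by positivity)
    rw [mul_assoc]
    refine mul_le_mul_of_nonneg_left ((hsumT.sum_le_tsum u₂ fun ρ _ ↦ hG0 ρ).trans htail) (by positivity)
  have := add_le_add hpart1 hpart2
  refine this.trans (le_of_eq ?_)
  ring

end Literature.NumberTheory.LFunctions.EntireEF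

end
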